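import Literature.NumberTheory.Automorphic.GKCohomologyTrivialTensor
import Literature.AlgebraicGeometry.ShimuraVarieties.UnitaryBallLieDerivative
import HarnessLib

/-!
# `(𝔤, K)`-cohomology of the trivial module: degree `0`, odd degrees, degrees above `dim 𝔤/𝔨`;
# the instance `G = U(2,1)`

Topic `RepresentationTheory/BorelWallach2000`; namespace `Literature.RepresentationTheory.BorelWallach2000`.
Theorems only (no definition, no named fact, no `sorry`).

The tree's `(𝔤, K)`-cohomology of a linear real group `G : RealMatrixGroup A N`
(`Literature.NumberTheory.Automorphic.gkComplex / gkCohomology`, on the Chevalley–Eilenberg complex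
`Literature.Algebra.Lie.ChevalleyEilenberg.*`; `K = G ∩ U(N)`, `𝔨 = 𝔤 ∩ 𝔲(N)`) is COMPUTED here for the
TRIVIAL `(𝔤, K)`-module on a complex vector space `E` — `K` acting by `1`, `𝔤` by `0`: the tree's
`GKTrivialTensor.trivK G`, `GKTrivialTensor.trivLie G`, compatibility `GKTrivialTensor.had_trivial G` — in
the degrees where no invariant theory is needed, and instantiated for `G = U(2,1)`
(`BallForms.u21Group`, the archimedean group of the Picard modular surfaces):

* §1 `cochain_apply_eq_of_forall_sub_mem` — a cochain horizontal for `K` (`i_x f = 0`, `x ∈ K`) only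
  depends on its arguments modulo `K` (`C^q(𝔤, 𝔨; V) = Hom_𝔨(Λ^q(𝔤/𝔨), V)`,
  [cite: BorelWallach2000, I §1.2 (1)]); `subsingleton_cohomology_of_carrier_eq_bot`.
* §2 **`H⁰(𝔤, K; E) ≅ E`**, `dim_ℂ H⁰(𝔤, K; ℂ) = 1` for every `G` (`gkInvariants_triv_eq_top`,
  `nonempty_gkCohomology_triv_zero_equiv`, `finrank_gkCohomology_triv_complex_zero`):
  `H⁰(𝔤, K; V) = V^{𝔤,K}` [cite: BorelWallach2000, I §1.2 (3), I §5.1 (4)] (tree: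
  `gkCohomologyZeroEquiv`) and every vector of the trivial module is invariant.
* §3 **odd degrees**: if some `k₀ ∈ K` acts by `-1` on `𝔤/𝔨` (`Ad(k₀) X + X ∈ 𝔨` for all `X ∈ 𝔤`), then
  `C^q(𝔤, K; E) = Hom_K(Λ^q(𝔤/𝔨), E) = 0` for odd `q` [cite: BorelWallach2000, I §5.1 (1)–(3)] (`k₀`
  acts on `Λ^q(𝔤/𝔨)` by `(-1)^q` and fixes every cochain of the complex), hence
  **`H^q(𝔤, K; E) = 0` for odd `q`** (`gkComplex_triv_carrier_eq_bot_of_odd`,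
  `subsingleton_gkCohomology_triv_of_odd`, `finrank_gkCohomology_triv_of_odd`).
* §4 **degrees above `dim 𝔤/𝔨`**: if `𝔤 = 𝔨 + T(W)` with `dim_ℝ W < q` then `C^q(𝔤, K; V) = 0` and
  `H^q(𝔤, K; V) = 0` for EVERY `(𝔤, K)`-module `V` (alternating `q`-forms on a space of dimension `< q`;
  [cite: BorelWallach2000, I §1.2 (1), I §1.4] `m = dim 𝔤/𝔨`) (`gkComplex_carrier_eq_bot_of_finrank_lt`,
  `subsingleton_gkCohomology_of_finrank_lt`, `finrank_gkCohomology_of_finrank_lt`).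
* §5 **`G = U(2,1)`** (`u21Group`; `K = U(2,1) ∩ U(3) = U(2) × U(1)`, `dim_ℝ 𝔤/𝔨 = 4`,
  [cite: BorelWallach2000, VI 4.7]): `J = diag(1,1,-1) ∈ K` with `Ad(J) X = J X J = -Xᴴ`
  (`mkU21_J_mem_maximalCompact`, `u21_Ad_J_add_mem_kInLie`), the decomposition `𝔲(2,1) = 𝔨 ⊕ 𝔭`,
  `𝔭 = {X_b : b ∈ ℂ²}` (`u21_sub_liePMat_mem_kInLie`, on the tree's `liePMat`), hence, hypothesis-free:
  **`H^q(𝔲(2,1), K; E) = 0` for odd `q`**, **`H^q(𝔲(2,1), K; V) = 0` for `q > 4` and every `V`**,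
  **`dim_ℂ H⁰(𝔲(2,1), K; ℂ) = 1`**, and the summary `u21_finrank_gkCohomology_triv_complex_eq_zero`:
  `dim_ℂ H^q(𝔲(2,1), K; ℂ) = 0` for `q ∉ {0, 2, 4}` — the row of the trivial representation `J_{0,0}`
  in [cite: BorelWallach2000, VI Thm. 4.11 (3)] (`n = 2`: `H^q(J_{0,0}) = ℂ` for `q = 2l`, `0 ≤ l ≤ 2`,
  `0` otherwise — the Betti numbers of `ℙ²(ℂ)`, I §1.6 (2)) outside the degrees `2, 4`, obtained from
  the actual complex rather than posited (cf. the dictionary `SUn1Table.VI_4_11`, field `hdim`, of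
  `SUn1CohomologicalModules`).

## What is NOT here

* The even degrees `q = 2, 4` for `U(2,1)` (`H² = ℂ·[ω]`, `H⁴ = ℂ·[vol]`): they need `d = 0` on
  `C^•(𝔤, K; ℂ)` (E. Cartan / [cite: BorelWallach2000, II Cor. 3.2]: for the trivial representation
  `H^q(𝔤, 𝔨; E) = C^q(𝔤, 𝔨; E) = (Λ^q 𝔭^*)^𝔨`) and the invariant theory of `U(2)` on `Λ^•(ℂ²)^*_ℝ`.
* `H^•(𝔤, K) = H^•(𝔤, 𝔨)` for connected `K`, Poincaré duality (I §1.4–1.5, I §7), non-trivial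
  coefficients.

## Sources (held text re-read 2026-08-21: `lit read doi:10.1090/surv/067`, chunks p0026–p0028 = I §1.2–1.6,
p0037 = I §5.1, p0062 = II 3.1–3.4, p0165 = VI 4.7, p0168 = VI 4.11)

* A. Borel, N. Wallach, *Continuous cohomology, discrete subgroups, and representations of reductive
  groups*, 2nd ed., Math. Surveys Monogr. 67, AMS (2000): I §1.2 (1) `C^q(𝔤,𝔨;V) = Hom_𝔨(Λ^q(𝔤/𝔨),V)`,
  (3) `H⁰(𝔤,V) = H⁰(𝔤,𝔨;V) = V^𝔤`; I §1.4 (`m = dim 𝔤/𝔨`, `C^m` one-dimensional); I §1.6 (2)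
  (E. Cartan: `H^*(𝔤,𝔨;V) = H^*(G/K;V)` for compact `G`); I §5.1 (1)–(4)
  `C^q(𝔤,K;V) = Hom_K(Λ^q(𝔤/𝔨),V)`, `H^q(𝔤,K;V) = H^q(𝔤,𝔨;V)^{K/K⁰}`; II Cor. 3.2; VI 4.7
  (`G = SU(n,1)`, `K = U(n+1) ∩ G`, `2q(G) = dim G - dim K = 2n`); VI Thm. 4.11 (3). [BorelWallach2000]

## Design notes

* Everything is stated on the tree's objects verbatim: `gkComplex G ρK ρ𝔤 had`, `gkCohomology G ρK ρ𝔤 had q`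
  with `(ρK, ρ𝔤, had) = (trivK G, trivLie G, had_trivial G)` for the trivial module; no abbreviation is
  introduced (theorems-only file).  Dimension statements are given for `Subsingleton` and for
  `Module.finrank S` over any non-trivial ring of scalars `S` acting on the cohomology (`S = ℝ`, the
  base ring of the complex, or `S = ℂ`, `gkCohomology.instModuleComplex`).
* The symmetry `k₀` of §3 is, for `U(p,q)` in the tree's presentation `{g : gᴴ J g = J}` with `J² = 1`,
  the matrix `J` itself (`Ad(J) X = J X J = -Xᴴ` on `𝔲(J)`); §5 carries this out for the tree's
  `u21Group` (`J = diag(1,1,-1)`); the same two lines apply verbatim to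
  `KonnoKonno2007.unitaryFormGroup J hJ hJJ` (not instantiated here).
-/

noncomputable section

open scoped Matrix MatrixGroups

namespace Literature.RepresentationTheory.BorelWallach2000

open Literature.Algebra.Lie Literature.Algebra.Lie.ChevalleyEilenberg
open Literature.NumberTheory.Automorphic Literature.NumberTheory.Automorphic.GKTrivialTensor

-- Mathlib idiom (as in `GKModules`, `GKCohomology`): commutator bracket on `Module.End` / matrices
attribute [local instance 100] LieRing.ofAssociativeRing

/-! ## §1 Two lemmas on the abstract complex -/

section Abstract

variable {R : Type*} [CommRing R] {L : Type*} [LieRing L] [LieAlgebra R L]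
  {M : Type*} [AddCommGroup M] [Module R M]

/-- **Horizontal cochains only see the arguments modulo `K`.**  If `i_x f = 0` for all `x` in a Lie
subalgebra `K` (the cochain `f` is *horizontal* for `K`, [cite: BorelWallach2000, I §1.2 (1)]:
`C^q(𝔤, 𝔨; V) = Hom_𝔨(Λ^q(𝔤/𝔨), V)`), then `f w = f v` whenever `w i - v i ∈ K` for every `i`.
[cite: BorelWallach2000, I §1.2 (1)] -/
theorem cochain_apply_eq_of_forall_sub_mem (K : LieSubalgebra R L) {q : ℕ} {f : Cochain R L M (q + 1)}
    (hf : ∀ x ∈ K, ins q x f = 0) (v w : Fin (q + 1) → L) (h : ∀ i, w i - v i ∈ K) : f w = f v := by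
  classical
  suffices key : ∀ s : Finset (Fin (q + 1)), f (fun i => if i ∈ s then w i else v i) = f v by
    simpa using key Finset.univ
  intro s
  induction s using Finset.induction_on with
  | empty => simp
  | insert j s hj ih =>
    have e1 : (fun i => if i ∈ insert j s then w i else v i) =
        Function.update (fun i => if i ∈ s then w i else v i) j (v j + (w j - v j)) := by
      funext i
      by_cases hij : i = j
      · subst hij
        simp
      · simp [Finset.mem_insert, hij]
    have e2 : Function.update (fun i => if i ∈ s then w i else v i) j (v j) =
        (fun i => if i ∈ s then w i else v i) := by
      rw [Function.update_eq_self_iff]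
      simp [hj]
    have e3 : f (Function.update (fun i => if i ∈ s then w i else v i) j (w j - v j)) = 0 :=
      apply_eq_zero_of_ins_eq_zero (hf _ (h j)) _ j (by simp)
    rw [e1, f.map_update_add, e2, e3, add_zero, ih]

variable [LieRingModule L M] [LieModule R L M]

/-- If a subcomplex has no non-zero cochains in degree `q`, its cohomology in degree `q` vanishes.
[folklore] -/
private theorem subsingleton_cohomology_of_carrier_eq_bot (S : Subcomplex R L M) (q : ℕ)
    (h : S.carrier q = ⊥) : Subsingleton (S.Cohomology q) := by
  have hz : ∀ z : S.cocycles q, z = 0 := fun z => by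
    have hz' := ((S.mem_cocycles_iff q _).1 z.2).1
    rw [h, Submodule.mem_bot] at hz'
    exact Subtype.ext hz'
  refine ⟨fun a b => ?_⟩
  obtain ⟨z, rfl⟩ := S.toCohomology_surjective q a
  obtain ⟨z', rfl⟩ := S.toCohomology_surjective q b
  rw [hz z, hz z']

end Abstract

/-! ## §2 The trivial `(𝔤, K)`-module of a linear real group: `H⁰(𝔤, K; E) = E` -/

section General

variable {A : Type*} [NormedCommRing A] [NormedAlgebra ℝ A] [NormedAlgebra ℚ A] [CompleteSpace A]
  [StarRing A] [StarModule ℝ A] {N : Type*} [Fintype N] [DecidableEq N] (G : RealMatrixGroup A N)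
  {V : Type*} [AddCommGroup V] [Module ℂ V]
  (ρK : Representation ℂ G.maximalCompact V) (ρ𝔤 : G.lie →ₗ⁅ℝ⁆ Module.End ℂ V)
  (hV : ∀ (k : G.maximalCompact) (X : G.lie),
    ρK k ∘ₗ ρ𝔤 X ∘ₗ ρK k⁻¹ = ρ𝔤 (G.Ad (Subgroup.inclusion G.maximalCompact_le_carrier k) X))
  (E : Type*) [AddCommGroup E] [Module ℂ E]

omit [StarModule ℝ A] in
/-- For the TRIVIAL `(𝔤, K)`-module `E` (`K` acts by `1`, `𝔤` by `0`: the tree's `GKTrivialTensor.trivK`,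
`GKTrivialTensor.trivLie`) every vector is `(𝔤, K)`-invariant: `E^{𝔤, K} = E`.
[cite: BorelWallach2000, I §1.2 (3)] -/
theorem gkInvariants_triv_eq_top :
    gkInvariants G (trivK G (E := E)) (trivLie G) = ⊤ := by
  rw [eq_top_iff]
  rintro v -
  rw [mem_gkInvariants_iff]
  exact ⟨fun X => by simp, fun k => by simp⟩

/-- **`H⁰(𝔤, K; E) ≅ E` for the trivial module** (as complex vector spaces):
`H⁰(𝔤, K; V) = V^{𝔤, K}` [cite: BorelWallach2000, I §1.2 (3), I §5.1 (4)] and `E^{𝔤,K} = E`. -/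
theorem nonempty_gkCohomology_triv_zero_equiv :
    Nonempty (gkCohomology G (trivK G (E := E)) (trivLie G) (had_trivial G) 0 ≃ₗ[ℂ] E) :=
  ⟨gkCohomologyZeroEquiv G (trivK G (E := E)) (trivLie G) (had_trivial G) ≪≫ₗ
    LinearEquiv.ofTop _ (gkInvariants_triv_eq_top G E)⟩

/-- `dim_ℂ H⁰(𝔤, K; E) = dim_ℂ E` for the trivial module. [cite: BorelWallach2000, I §1.2 (3)] -/
theorem finrank_gkCohomology_triv_zero :
    Module.finrank ℂ (gkCohomology G (trivK G (E := E)) (trivLie G) (had_trivial G) 0) =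
      Module.finrank ℂ E :=
  (nonempty_gkCohomology_triv_zero_equiv G E).some.finrank_eq

/-- **`dim_ℂ H⁰(𝔤, K; ℂ) = 1`**: the `(𝔤, K)`-cohomology of the trivial one-dimensional module in
degree `0` is one-dimensional, for every linear real group `G`.
[cite: BorelWallach2000, I §1.2 (3), I §5.1 (4)] -/
theorem finrank_gkCohomology_triv_complex_zero :
    Module.finrank ℂ (gkCohomology G (trivK G (E := ℂ)) (trivLie G) (had_trivial G) 0) = 1 := by
  rw [finrank_gkCohomology_triv_zero, Module.finrank_self]

end General

/-! ## §3 Odd degrees: an element of `K` acting by `-1` on `𝔤/𝔨` kills `C^{odd}(𝔤, K; E)` -/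

section Odd

variable {A : Type*} [NormedCommRing A] [NormedAlgebra ℝ A] [NormedAlgebra ℚ A] [CompleteSpace A]
  [StarRing A] [StarModule ℝ A] {N : Type*} [Fintype N] [DecidableEq N] (G : RealMatrixGroup A N)
  (E : Type*) [AddCommGroup E] [Module ℂ E]

/-- **Odd-degree vanishing of the complex (trivial coefficients).**  Suppose some `k₀ ∈ K` acts by
`-1` on `𝔤/𝔨`, i.e. `Ad(k₀) X + X ∈ 𝔨` for all `X ∈ 𝔤` (e.g. the matrix of the hermitian form for
`U(p,q)`, a "symmetry at the base point" of `G/K`).  Then the `(𝔤, K)`-complex of the trivial module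
`E` has NO non-zero cochains in odd degrees: a cochain `f ∈ C^q(𝔤, K; E) = Hom_K(Λ^q(𝔤/𝔨), E)`
[cite: BorelWallach2000, I §5.1 (1)] is fixed by `k₀`, which acts on `Λ^q(𝔤/𝔨)` by `(-1)^q`.
[cite: BorelWallach2000, I §5.1 (1)–(3)] -/
theorem gkComplex_triv_carrier_eq_bot_of_odd (k₀ : G.maximalCompact)
    (hk₀ : ∀ X : G.lie, G.Ad (Subgroup.inclusion G.maximalCompact_le_carrier k₀) X + X ∈ G.kInLie)
    {q : ℕ} (hq : Odd q) :
    (gkComplex G (trivK G (E := E)) (trivLie G) (had_trivial G)).carrier q = ⊥ := by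
  obtain ⟨r, rfl⟩ := hq
  rw [eq_bot_iff]
  intro f hf
  rw [Submodule.mem_bot]
  obtain ⟨hrel, hfix⟩ := (mem_gkComplex_succ_iff G _ _ (had_trivial G) (2 * r) f).1 hf
  ext v
  -- (1) `k₀`-fixedness: `f (Ad k₀ ∘ v) = f v`
  have h1 : f (fun i => G.Ad (Subgroup.inclusion G.maximalCompact_le_carrier k₀) (v i)) = f v := by
    have e := congrArg
      (fun g : Cochain ℝ G.lie (GKCarrier G (trivLie G (E := E))) (2 * r + 1) => g v) (hfix k₀⁻¹)
    simp only [ChevalleyEilenberg.PairAction.act_apply, inv_inv] at e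
    exact e
  -- (2) horizontality: `f (Ad k₀ ∘ v) = f (-v)` since `Ad k₀ (v i) - (-v i) ∈ 𝔨`
  have h2 : f (fun i => G.Ad (Subgroup.inclusion G.maximalCompact_le_carrier k₀) (v i)) =
      f (fun i => -v i) :=
    cochain_apply_eq_of_forall_sub_mem G.kInLie (fun x hx => (hrel x hx).2) _ _
      (fun i => by simpa [sub_neg_eq_add] using hk₀ (v i))
  -- (3) multilinearity: `f (-v) = (-1)^{2r+1} f v = - f v`
  have h3 : f (fun i => -v i) = -f v := by
    have e := (f : MultilinearMap ℝ (fun _ : Fin (2 * r + 1) => G.lie)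
      (GKCarrier G (trivLie G (E := E)))).map_smul_univ (fun _ => (-1 : ℝ)) v
    simp only [AlternatingMap.coe_multilinearMap, neg_one_smul, Finset.prod_const, Finset.card_univ,
      Fintype.card_fin] at e
    rw [e, pow_succ, pow_mul, neg_one_sq, one_pow, one_mul, neg_one_smul]
  have h4 : f v = -f v := by rw [← h3, ← h2, h1]
  have h5 : (2 : ℝ) • f v = 0 := by
    rw [two_smul]
    nth_rewrite 2 [h4]
    exact add_neg_cancel _
  rw [AlternatingMap.zero_apply]
  exact (smul_eq_zero.1 h5).resolve_left two_ne_zero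

/-- **`H^q(𝔤, K; E) = 0` for odd `q`** (trivial module), as soon as some `k₀ ∈ K` acts by `-1` on
`𝔤/𝔨`. [cite: BorelWallach2000, I §5.1 (1)–(4)] -/
theorem subsingleton_gkCohomology_triv_of_odd (k₀ : G.maximalCompact)
    (hk₀ : ∀ X : G.lie, G.Ad (Subgroup.inclusion G.maximalCompact_le_carrier k₀) X + X ∈ G.kInLie)
    {q : ℕ} (hq : Odd q) :
    Subsingleton (gkCohomology G (trivK G (E := E)) (trivLie G) (had_trivial G) q) :=
  subsingleton_cohomology_of_carrier_eq_bot _ q (gkComplex_triv_carrier_eq_bot_of_odd G E k₀ hk₀ hq)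

/-- `dim H^q(𝔤, K; E) = 0` for odd `q` under the same hypothesis (any scalars `S` for which the
dimension is taken, e.g. `S = ℝ` or `ℂ`). [cite: BorelWallach2000, I §5.1 (1)–(4)] -/
theorem finrank_gkCohomology_triv_of_odd (k₀ : G.maximalCompact)
    (hk₀ : ∀ X : G.lie, G.Ad (Subgroup.inclusion G.maximalCompact_le_carrier k₀) X + X ∈ G.kInLie)
    {q : ℕ} (hq : Odd q) (S : Type*) [Ring S] [Nontrivial S]
    [Module S (gkCohomology G (trivK G (E := E)) (trivLie G) (had_trivial G) q)] :
    Module.finrank S (gkCohomology G (trivK G (E := E)) (trivLie G) (had_trivial G) q) = 0 :=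
  haveI := subsingleton_gkCohomology_triv_of_odd G E k₀ hk₀ hq
  Module.finrank_zero_of_subsingleton

end Odd

/-! ## §4 Degrees above `dim 𝔤/𝔨`: no cochains at all (any coefficients) -/

section Top

variable {A : Type*} [NormedCommRing A] [NormedAlgebra ℝ A] [NormedAlgebra ℚ A] [CompleteSpace A]
  [StarRing A] [StarModule ℝ A] {N : Type*} [Fintype N] [DecidableEq N] (G : RealMatrixGroup A N)
  {V : Type*} [AddCommGroup V] [Module ℂ V]
  (ρK : Representation ℂ G.maximalCompact V) (ρ𝔤 : G.lie →ₗ⁅ℝ⁆ Module.End ℂ V)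
  (hV : ∀ (k : G.maximalCompact) (X : G.lie),
    ρK k ∘ₗ ρ𝔤 X ∘ₗ ρK k⁻¹ = ρ𝔤 (G.Ad (Subgroup.inclusion G.maximalCompact_le_carrier k) X))

/-- **No cochains above `dim 𝔤/𝔨`.**  If `𝔤 = 𝔨 + T(W)` for a real-linear map `T` from a
finite-dimensional real space `W` (so `dim 𝔤/𝔨 ≤ dim W`), then `C^q(𝔤, K; V) = 0` for every
`q > dim W` and every `(𝔤, K)`-module `V`: a cochain in `C^q(𝔤, K; V) = Hom_K(Λ^q(𝔤/𝔨), V)` is an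
alternating `q`-form on a space of dimension `< q` [cite: BorelWallach2000, I §1.2 (1), I §1.4
(`m = dim 𝔤/𝔨`), I §5.1 (1)]. -/
theorem gkComplex_carrier_eq_bot_of_finrank_lt {W : Type*} [AddCommGroup W] [Module ℝ W]
    [FiniteDimensional ℝ W] (T : W →ₗ[ℝ] G.lie) (hT : ∀ X : G.lie, ∃ w : W, X - T w ∈ G.kInLie)
    {q : ℕ} (hq : Module.finrank ℝ W < q) :
    (gkComplex G ρK ρ𝔤 hV).carrier q = ⊥ := by
  obtain ⟨n, rfl⟩ : ∃ n, q = n + 1 := ⟨q - 1, by omega⟩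
  rw [eq_bot_iff]
  intro f hf
  rw [Submodule.mem_bot]
  obtain ⟨hrel, -⟩ := (mem_gkComplex_succ_iff G ρK ρ𝔤 hV n f).1 hf
  ext v
  choose c hc using fun i => hT (v i)
  have h1 : f v = f (fun i => T (c i)) :=
    cochain_apply_eq_of_forall_sub_mem G.kInLie (fun x hx => (hrel x hx).2) _ _ hc
  have h2 : f (fun i => T (c i)) = 0 := by
    refine AlternatingMap.map_linearDependent f _ fun hli => ?_
    have hli' : LinearIndependent ℝ c := LinearIndependent.of_comp T hli
    have hcard := hli'.fintype_card_le_finrank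
    rw [Fintype.card_fin] at hcard
    omega
  rw [h1, h2, AlternatingMap.zero_apply]

/-- **`H^q(𝔤, K; V) = 0` for `q > dim 𝔤/𝔨`** (in the form: `𝔤 = 𝔨 + T(W)`, `q > dim W`), for every
`(𝔤, K)`-module `V`. [cite: BorelWallach2000, I §1.2 (1), I §1.4, I §5.1 (4)] -/
theorem subsingleton_gkCohomology_of_finrank_lt {W : Type*} [AddCommGroup W] [Module ℝ W]
    [FiniteDimensional ℝ W] (T : W →ₗ[ℝ] G.lie) (hT : ∀ X : G.lie, ∃ w : W, X - T w ∈ G.kInLie)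
    {q : ℕ} (hq : Module.finrank ℝ W < q) :
    Subsingleton (gkCohomology G ρK ρ𝔤 hV q) :=
  subsingleton_cohomology_of_carrier_eq_bot _ q
    (gkComplex_carrier_eq_bot_of_finrank_lt G ρK ρ𝔤 hV T hT hq)

/-- `dim H^q(𝔤, K; V) = 0` for `q > dim 𝔤/𝔨` (same form), over any scalars.
[cite: BorelWallach2000, I §1.2 (1), I §1.4, I §5.1 (4)] -/
theorem finrank_gkCohomology_of_finrank_lt {W : Type*} [AddCommGroup W] [Module ℝ W]
    [FiniteDimensional ℝ W] (T : W →ₗ[ℝ] G.lie) (hT : ∀ X : G.lie, ∃ w : W, X - T w ∈ G.kInLie)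
    {q : ℕ} (hq : Module.finrank ℝ W < q) (S : Type*) [Ring S] [Nontrivial S]
    [Module S (gkCohomology G ρK ρ𝔤 hV q)] :
    Module.finrank S (gkCohomology G ρK ρ𝔤 hV q) = 0 :=
  haveI := subsingleton_gkCohomology_of_finrank_lt G ρK ρ𝔤 hV T hT hq
  Module.finrank_zero_of_subsingleton

end Top

/-! ## §5 The instance `G = U(2,1)` (`BallForms.u21Group`): `K = U(2) × U(1)`, `dim 𝔤/𝔨 = 4` -/

section U21

open Literature.Geometry.ComplexHyperbolic Literature.Geometry.ComplexHyperbolic.BallModel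
open Literature.AlgebraicGeometry.ShimuraVarieties Literature.AlgebraicGeometry.ShimuraVarieties.BallForms

variable (E : Type*) [AddCommGroup E] [Module ℂ E]

/-- `Jᴴ J J = J` for `J = diag(1,1,-1)`: the matrix `J` itself lies in `U(2,1)`. [folklore] -/
private theorem conjTranspose_J_mul_J_mul_J : Jᴴ * J * J = J := by
  rw [conjTranspose_J, Matrix.mul_assoc, J_mul_J, Matrix.mul_one]

/-- `J = diag(1,1,-1)` lies in `K = U(2,1) ∩ U(3)` (it is unitary). [folklore] -/
private theorem mkU21_J_mem_maximalCompact :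
    ((mkU21 J conjTranspose_J_mul_J_mul_J : U21) : GL (Fin 3) ℂ) ∈ u21Group.maximalCompact := by
  rw [RealMatrixGroup.mem_maximalCompact_iff]
  refine ⟨(mkU21 J conjTranspose_J_mul_J_mul_J).2, ?_⟩
  show star J * J = 1
  rw [Matrix.star_eq_conjTranspose, conjTranspose_J, J_mul_J]

/-- For `X ∈ 𝔲(2,1)`: `Xᴴ = -J X J`. [folklore] -/
private theorem conjTranspose_eq_of_mem_u21Lie (X : u21Group.lie) :
    (X : Matrix (Fin 3) (Fin 3) ℂ)ᴴ = -(J * X * J) := by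
  have hX : (X : Matrix (Fin 3) (Fin 3) ℂ)ᴴ * J + J * X = 0 := X.2
  have h1 : (X : Matrix (Fin 3) (Fin 3) ℂ)ᴴ * J = -(J * X) := eq_neg_of_add_eq_zero_left hX
  calc (X : Matrix (Fin 3) (Fin 3) ℂ)ᴴ = (X : Matrix (Fin 3) (Fin 3) ℂ)ᴴ * J * J := by
        rw [Matrix.mul_assoc, J_mul_J, Matrix.mul_one]
    _ = -(J * X * J) := by rw [h1, Matrix.neg_mul]

/-- **`Ad(J)` acts by `-1` on `𝔲(2,1)/𝔨`**: `Ad(J) X = J X J = -Xᴴ`, so `Ad(J) X + X = X - Xᴴ` is a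
skew-hermitian element of `𝔲(2,1)`, i.e. lies in `𝔨 = 𝔲(2,1) ∩ 𝔲(3)`: `Ad(J)` is the Cartan
involution `θ` of `U(2,1)` (fixed points `𝔨`, `-1` on `𝔭`) [cite: BorelWallach2000, 0 §3.3 and II §1.1 (3)].
[folklore] -/
private theorem u21_Ad_J_add_mem_kInLie (X : u21Group.lie) :
    u21Group.Ad (Subgroup.inclusion u21Group.maximalCompact_le_carrier
        ⟨_, mkU21_J_mem_maximalCompact⟩) X + X ∈ u21Group.kInLie := by
  rw [RealMatrixGroup.mem_kInLie_iff, RealMatrixGroup.mem_compactLie_iff]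
  refine ⟨(_ : u21Group.lie).2, ?_⟩
  have hg : (((Subgroup.inclusion u21Group.maximalCompact_le_carrier
      ⟨_, mkU21_J_mem_maximalCompact⟩ : u21Group.carrier) : GL (Fin 3) ℂ) : Matrix (Fin 3) (Fin 3) ℂ)
      = J := rfl
  have hginv : ((((Subgroup.inclusion u21Group.maximalCompact_le_carrier
      ⟨_, mkU21_J_mem_maximalCompact⟩ : u21Group.carrier) : GL (Fin 3) ℂ)⁻¹ : GL (Fin 3) ℂ) :
        Matrix (Fin 3) (Fin 3) ℂ) = J := by
    rw [Matrix.coe_units_inv, hg, Matrix.inv_eq_left_inv J_mul_J]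
  rw [AddMemClass.coe_add, RealMatrixGroup.Ad_apply_coe, hg, hginv, Matrix.star_eq_conjTranspose,
    Matrix.conjTranspose_add, Matrix.conjTranspose_mul, Matrix.conjTranspose_mul, conjTranspose_J,
    conjTranspose_eq_of_mem_u21Lie X]
  simp only [Matrix.neg_mul, Matrix.mul_neg, Matrix.mul_assoc, J_mul_J, Matrix.mul_one, neg_add_rev]
  rw [← Matrix.mul_assoc J J, J_mul_J, Matrix.one_mul]

/-- **Cartan decomposition `𝔲(2,1) = 𝔨 ⊕ 𝔭`** (`𝔭 = {x | θ x = -x}` the hermitian elements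
`X_b`, `b ∈ ℂ²`, of `𝔲(2,1)`; `𝔨` the skew-hermitian ones): every `X ∈ 𝔲(2,1)` differs from `X_b ∈ 𝔭`
with `b = (X₀₂, X₁₂)` (the tree's `liePMat b`) by an element of `𝔨 = 𝔲(2,1) ∩ 𝔲(3)` (its block-diagonal
part). [cite: BorelWallach2000, II §1.1 (3)] -/
theorem u21_sub_liePMat_mem_kInLie (X : u21Group.lie) :
    X - liePMat ![(X : Matrix (Fin 3) (Fin 3) ℂ) 0 2, (X : Matrix (Fin 3) (Fin 3) ℂ) 1 2] ∈
      u21Group.kInLie := by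
  rw [RealMatrixGroup.mem_kInLie_iff, RealMatrixGroup.mem_compactLie_iff]
  refine ⟨(_ : u21Group.lie).2, ?_⟩
  have hX : (X : Matrix (Fin 3) (Fin 3) ℂ)ᴴ * J + J * X = 0 := X.2
  have hrel : ∀ i j : Fin 3, (starRingEnd ℂ) ((X : Matrix (Fin 3) (Fin 3) ℂ) j i) * J j j +
      J i i * (X : Matrix (Fin 3) (Fin 3) ℂ) i j = 0 := by
    intro i j
    have h := congrFun (congrFun hX i) j
    simpa [J, Matrix.add_apply, Matrix.mul_diagonal, Matrix.diagonal_mul, Matrix.conjTranspose_apply]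
      using h
  have h00 := hrel 0 0
  have h01 := hrel 0 1
  have h02 := hrel 0 2
  have h10 := hrel 1 0
  have h11 := hrel 1 1
  have h12 := hrel 1 2
  have h20 := hrel 2 0
  have h21 := hrel 2 1
  have h22 := hrel 2 2
  simp only [J_apply_00, J_apply_11, J_apply_22, mul_one, one_mul, mul_neg] at h00 h01 h02 h10 h11 h12 h20 h21 h22
  rw [AddSubgroupClass.coe_sub, coe_liePMat, Matrix.star_eq_conjTranspose]
  ext i j
  fin_cases i <;> fin_cases j
  · simp [Matrix.conjTranspose_apply, Matrix.sub_apply, pMat]; linear_combination h00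
  · simp [Matrix.conjTranspose_apply, Matrix.sub_apply, pMat]; linear_combination h01
  · simp [Matrix.conjTranspose_apply, Matrix.sub_apply, pMat]; linear_combination -h02
  · simp [Matrix.conjTranspose_apply, Matrix.sub_apply, pMat]; linear_combination h10
  · simp [Matrix.conjTranspose_apply, Matrix.sub_apply, pMat]; linear_combination h11
  · simp [Matrix.conjTranspose_apply, Matrix.sub_apply, pMat]; linear_combination -h12
  · simp [Matrix.conjTranspose_apply, Matrix.sub_apply, pMat]; linear_combination -h20
  · simp [Matrix.conjTranspose_apply, Matrix.sub_apply, pMat]; linear_combination -h21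
  · simp [Matrix.conjTranspose_apply, Matrix.sub_apply, pMat]; linear_combination -h22

/-- **`H^q(𝔲(2,1), K; E) = 0` for every odd `q`** (trivial module; in particular `H¹ = H³ = 0`):
the odd-degree criterion applied with `k₀ = J = diag(1,1,-1) ∈ K = U(2) × U(1)`.  These are the
odd-degree entries of the row of the trivial representation `J_{0,0}` in the table of
[cite: BorelWallach2000, VI Thm. 4.11 (3)] (`n = 2`: `H^q(J_{0,0}) ≠ 0` only for `q = 0, 2, 4`, the
cohomology of `ℙ²(ℂ)`, cf. I §1.6 (2)), computed here from the actual complex. -/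
theorem u21_subsingleton_gkCohomology_triv_of_odd {q : ℕ} (hq : Odd q) :
    Subsingleton (gkCohomology u21Group (trivK u21Group (E := E)) (trivLie u21Group)
      (had_trivial u21Group) q) :=
  subsingleton_gkCohomology_triv_of_odd u21Group E ⟨_, mkU21_J_mem_maximalCompact⟩
    u21_Ad_J_add_mem_kInLie hq

/-- `dim H^q(𝔲(2,1), K; E) = 0` for odd `q` (trivial module), over any scalars.
[cite: BorelWallach2000, VI Thm. 4.11 (3)] -/
theorem u21_finrank_gkCohomology_triv_of_odd {q : ℕ} (hq : Odd q) (S : Type*) [Ring S] [Nontrivial S]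
    [Module S (gkCohomology u21Group (trivK u21Group (E := E)) (trivLie u21Group)
      (had_trivial u21Group) q)] :
    Module.finrank S (gkCohomology u21Group (trivK u21Group (E := E)) (trivLie u21Group)
      (had_trivial u21Group) q) = 0 :=
  finrank_gkCohomology_triv_of_odd u21Group E ⟨_, mkU21_J_mem_maximalCompact⟩
    u21_Ad_J_add_mem_kInLie hq S

/-- `dim_ℝ ℂ² = 4` (`= dim_ℝ 𝔭 = dim U(2,1)/K`, [cite: BorelWallach2000, VI 4.7 (1)]: `2q(G) = 2n`).
[folklore] -/
private theorem finrank_real_fin_two_complex : Module.finrank ℝ (Fin 2 → ℂ) = 4 := by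
  rw [Module.finrank_pi_fintype, Complex.finrank_real_complex]
  simp

/-- **`H^q(𝔲(2,1), K; V) = 0` for `q > 4 = dim U(2,1)/K`, for every `(𝔤, K)`-module `V`** of
`U(2,1)` (`𝔲(2,1) = 𝔨 ⊕ 𝔭`, `𝔭 = {X_b : b ∈ ℂ²}` real `4`-dimensional).
[cite: BorelWallach2000, I §1.4, VI 4.7 (1)] -/
theorem u21_subsingleton_gkCohomology_of_four_lt {V : Type*} [AddCommGroup V] [Module ℂ V]
    (ρK : Representation ℂ u21Group.maximalCompact V) (ρ𝔤 : u21Group.lie →ₗ⁅ℝ⁆ Module.End ℂ V)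
    (hV : ∀ (k : u21Group.maximalCompact) (X : u21Group.lie), ρK k ∘ₗ ρ𝔤 X ∘ₗ ρK k⁻¹ =
      ρ𝔤 (u21Group.Ad (Subgroup.inclusion u21Group.maximalCompact_le_carrier k) X))
    {q : ℕ} (hq : 4 < q) : Subsingleton (gkCohomology u21Group ρK ρ𝔤 hV q) :=
  subsingleton_gkCohomology_of_finrank_lt u21Group ρK ρ𝔤 hV
    ({ toFun := liePMat
       map_add' := fun b c => Subtype.ext (pMat_add b c)
       map_smul' := fun r b => (smul_liePMat r b).symm } : (Fin 2 → ℂ) →ₗ[ℝ] u21Group.lie)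
    (fun X => ⟨_, u21_sub_liePMat_mem_kInLie X⟩) (by rwa [finrank_real_fin_two_complex])

/-- `dim H^q(𝔲(2,1), K; V) = 0` for `q > 4`, any `(𝔤, K)`-module `V`, any scalars.
[cite: BorelWallach2000, I §1.4, VI 4.7 (1)] -/
theorem u21_finrank_gkCohomology_of_four_lt {V : Type*} [AddCommGroup V] [Module ℂ V]
    (ρK : Representation ℂ u21Group.maximalCompact V) (ρ𝔤 : u21Group.lie →ₗ⁅ℝ⁆ Module.End ℂ V)
    (hV : ∀ (k : u21Group.maximalCompact) (X : u21Group.lie), ρK k ∘ₗ ρ𝔤 X ∘ₗ ρK k⁻¹ =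
      ρ𝔤 (u21Group.Ad (Subgroup.inclusion u21Group.maximalCompact_le_carrier k) X))
    {q : ℕ} (hq : 4 < q) (S : Type*) [Ring S] [Nontrivial S] [Module S (gkCohomology u21Group ρK ρ𝔤 hV q)] :
    Module.finrank S (gkCohomology u21Group ρK ρ𝔤 hV q) = 0 :=
  haveI := u21_subsingleton_gkCohomology_of_four_lt ρK ρ𝔤 hV hq
  Module.finrank_zero_of_subsingleton

/-- **`dim_ℂ H⁰(𝔲(2,1), K; ℂ) = 1`.** [cite: BorelWallach2000, I §1.2 (3), VI Thm. 4.11 (3)] -/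
theorem u21_finrank_gkCohomology_triv_complex_zero :
    Module.finrank ℂ (gkCohomology u21Group (trivK u21Group (E := ℂ)) (trivLie u21Group)
      (had_trivial u21Group) 0) = 1 :=
  finrank_gkCohomology_triv_complex_zero u21Group

/-- **The row of the trivial representation, outside the degrees `0, 2, 4`**: for `G = U(2,1)` and
the trivial module `ℂ`, `dim_ℂ H^q(𝔤, K; ℂ) = 0` unless `q ∈ {0, 2, 4}` — the "otherwise `0`" half of
[cite: BorelWallach2000, VI Thm. 4.11 (3)] for `J_{0,0}`, `n = 2` (degrees `q = 2l`, `0 ≤ l ≤ 2`),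
proved from the complex: odd `q` by the symmetry `J`, `q > 4` because `dim 𝔤/𝔨 = 4`.  (Degrees `2`
and `4`, where the printed value is `ℂ`, are NOT treated in this file.) -/
theorem u21_finrank_gkCohomology_triv_complex_eq_zero {q : ℕ} (h0 : q ≠ 0) (h2 : q ≠ 2)
    (h4 : q ≠ 4) :
    Module.finrank ℂ (gkCohomology u21Group (trivK u21Group (E := ℂ)) (trivLie u21Group)
      (had_trivial u21Group) q) = 0 := by
  rcases Nat.even_or_odd q with hq | hq
  · have h4q : 4 < q := by
      obtain ⟨r, rfl⟩ := hq
      omega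
    exact u21_finrank_gkCohomology_of_four_lt _ _ _ h4q ℂ
  · exact u21_finrank_gkCohomology_triv_of_odd ℂ hq ℂ

end U21

end Literature.RepresentationTheory.BorelWallach2000
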